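import Summits.HodgeConjecture.HodgeConjecture.Theses.BoundaryReadout
import Literature.AlgebraicGeometry.HodgeTheory.IsoTransport
import HarnessLib

/-!
# Route `BoundaryReadout` — crux `AbsoluteReduction` (stmt-HodgeConjecture-15945), line `generic-flatness`,
# stub S1: absolute Hodge classes transport along isomorphisms

Helper file for the crux item stmt-HodgeConjecture-15945 (`--supports`; it closes nothing): it proves
the registered stub `stub_absoluteOfIso` of the skeleton
`Cruxes/AbsoluteReduction/Lines/generic_flatness.lean`, verbatim:

> for an isomorphism `e : X' ≅ X` of smooth projective `ℂ`-schemes of dimension `n` and an absolute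
> Hodge class `c ∈ H²ᵖ(X(ℂ); ℂ)`, the class `e^* c` is absolute Hodge on `X'`.

## Proof

Rationality and Hodge type transport along `e` (`isRationalClass_map_iff_of_iso`,
`isOfHodgeType_map_iff_of_iso`, file `HodgeTheory/IsoTransport`). For the conjugation clauses of
`IsAbsoluteHodgeClass` (Charles–Schnell Def. 11.2.3 read through conjugation charts,
`HodgeTheory/AbsoluteHodgeClasses`): a conjugation chart `D = (Y, π, Y^an, (Y^σ)^an, e_dR)` of `X`
composed with a `ℂ`-morphism `g : X ⟶ X'` whose conjugate `g^σ` is injective on `Hᵏ` is a chart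
`(Y, π ≫ g, …)` of `X'` with the SAME affine `Y`, analytic models and de Rham family and structure map
`π ≫ g` (`(π ≫ g)^σ = π^σ ≫ g^σ` since conjugation `conjHom σ` is the base-change functor), and
in it `(a, b)` is a conjugate pair as soon as `(g^* a, (g^σ)^* b)` is one in `D`
(`isConjugateClass_of_conjugates_map`: the presenting algebraic form expression is the same). With
`g = e⁻¹` this carries the conjugates `c'` of `c` to the conjugates `(e^σ)^* c'` of `e^* c`
(existence clause); with `g = e` applied to an ARBITRARY chart of `X'` it carries a conjugate `c''`
of `e^* c` back to the conjugate `((e⁻¹)^σ)^* c''` of `c`, which is `periodTwist σ p • β` with `β`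
rational of type `(p,p)` on `X^σ` by absoluteness of `c`, whence
`c'' = periodTwist σ p • (e^σ)^* β` with `(e^σ)^* β` rational of type `(p,p)` on `X'^σ`
(transport along the isomorphism `e^σ : X'^σ ≅ X^σ`).

## Main result

* `stub_absoluteOfIso` — the registered stub S1 (name and signature verbatim), PROVED (standard axioms).

## References

* F. Charles, C. Schnell, *Notes on absolute Hodge classes* (2014), Def. 11.2.3, §11.2.2
  (11.2.1)–(11.2.3). [CharlesSchnell2014Notes]
* J.-P. Jouanolou, *Une suite exacte de Mayer–Vietoris en K-théorie algébrique*, LNM 341 (1973),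
  Lemme 1.5. [Jouanolou1973]
-/

-- every declaration of this problem lives in `Summit.HodgeConjecture.HodgeConjecture.…`
-- (single-problem summit: Problem = Summit), which `linter.dupNamespace` flags; set so that
-- stand-alone elaboration is warning-free.
set_option linter.dupNamespace false

noncomputable section

namespace Summit.HodgeConjecture.HodgeConjecture.Theorems

open CategoryTheory AlgebraicGeometry
open Literature.AlgebraicGeometry Literature.AlgebraicGeometry.Motives
open Literature.AlgebraicGeometry.HodgeTheory
open Literature.AlgebraicTopology.SingularHomology Literature.NumberTheory.Transcendental

namespace AbsoluteReductionAbsoluteOfIso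

variable {σ : ℂ ≃+* ℂ} {X X' : SchemeOver ℂ} {k : ℕ}

/-- `(g^σ)^* ∘ (h^σ)^* = ((g ≫ h)^σ)^*` applied to a class: conjugation `conjHom σ` is a functor and
`complexBetti.map` is contravariantly functorial. [cite: CharlesSchnell2014Notes, §11.2.2 (11.2.1)] -/
theorem map_conjHom_map_conjHom_apply {X'' : SchemeOver ℂ} (g : X ⟶ X') (h : X' ⟶ X'')
    (x : complexBetti (conjugateVariety σ X'') k) :
    complexBetti.map (conjHom σ g) k (complexBetti.map (conjHom σ h) k x) =
      complexBetti.map (conjHom σ (g ≫ h)) k x := by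
  have h' : conjHom σ (g ≫ h) = conjHom σ g ≫ conjHom σ h := CategoryTheory.Functor.map_comp _ _ _
  rw [h', complexBetti.map_comp]
  rfl

/-- `(e^σ)^* ((e⁻¹)^σ)^* x = x` for an isomorphism `e : X' ≅ X`. [folklore] -/
theorem map_conjHom_hom_map_conjHom_inv_apply (e : X' ≅ X)
    (x : complexBetti (conjugateVariety σ X') k) :
    complexBetti.map (conjHom σ e.hom) k (complexBetti.map (conjHom σ e.inv) k x) = x := by
  have h : conjHom σ (𝟙 X') = 𝟙 (conjugateVariety σ X') := CategoryTheory.Functor.map_id _ _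
  rw [map_conjHom_map_conjHom_apply, e.hom_inv_id, h, complexBetti.map_id]
  rfl

/-- `((e⁻¹)^σ)^* (e^σ)^* x = x` for an isomorphism `e : X' ≅ X`. [folklore] -/
theorem map_conjHom_inv_map_conjHom_hom_apply (e : X' ≅ X)
    (x : complexBetti (conjugateVariety σ X) k) :
    complexBetti.map (conjHom σ e.inv) k (complexBetti.map (conjHom σ e.hom) k x) = x := by
  have h : conjHom σ (𝟙 X) = 𝟙 (conjugateVariety σ X) := CategoryTheory.Functor.map_id _ _
  rw [map_conjHom_map_conjHom_apply, e.inv_hom_id, h, complexBetti.map_id]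
  rfl

/-- `(e^σ)^*` is injective for an isomorphism `e : X' ≅ X` (it is `((e)^σ)^*` for the isomorphism
`e^σ : X'^σ ≅ X^σ`). [folklore] -/
theorem injective_map_conjHom_hom (e : X' ≅ X) :
    Function.Injective (complexBetti.map (conjHom σ e.hom) k) :=
  (complexBetti.bijective_map_of_iso ((baseChangeHom σ.toRingHom).mapIso e) k).1

/-- `((e⁻¹)^σ)^*` is injective for an isomorphism `e : X' ≅ X`. [folklore] -/
theorem injective_map_conjHom_inv (e : X' ≅ X) :
    Function.Injective (complexBetti.map (conjHom σ e.inv) k) :=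
  (complexBetti.bijective_map_of_iso ((baseChangeHom σ.toRingHom).mapIso e.symm) k).1

/-- **Transport of conjugate pairs along a morphism (chart composition).** Let `D = (Y, π, …)` be a
conjugation chart for `(σ, X, k)` and `g : X ⟶ X'` a `ℂ`-morphism whose conjugate `g^σ` is injective
on `Hᵏ(–(ℂ); ℂ)`. If `(g^* a, (g^σ)^* b)` is a conjugate pair in `D`, then `b` is a `σ`-conjugate of
`a` on `X'`: the chart `(Y, π ≫ g, …)` with the SAME affine `Y`, analytic models and de Rham family
(`((π ≫ g)^σ)^* = (π^σ)^* ∘ (g^σ)^*` is injective) and the same presenting closed algebraic form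
expression witness it, as `(π ≫ g)^* a = π^* (g^* a)` and `((π ≫ g)^σ)^* b = (π^σ)^* ((g^σ)^* b)`.
[cite: CharlesSchnell2014Notes, §11.2.2 (11.2.3)] [cite: Jouanolou1973, Lemme 1.5] -/
theorem isConjugateClass_of_conjugates_map (D : ConjugationChart σ X k) (g : X ⟶ X')
    (hg : Function.Injective (complexBetti.map (conjHom σ g) k)) {a : complexBetti X' k}
    {b : complexBetti (conjugateVariety σ X') k}
    (h : D.Conjugates (complexBetti.map g k a) (complexBetti.map (conjHom σ g) k b)) :
    IsConjugateClass σ X' k a b := by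
  obtain ⟨ξ, hξ, hξ', e₁, e₂⟩ := h
  have hinj : Function.Injective (complexBetti.map (conjHom σ (D.π ≫ g)) k) := by
    intro x y hxy
    have h' : complexBetti.map (conjHom σ D.π) k (complexBetti.map (conjHom σ g) k x) =
        complexBetti.map (conjHom σ D.π) k (complexBetti.map (conjHom σ g) k y) := by
      rwa [map_conjHom_map_conjHom_apply, map_conjHom_map_conjHom_apply]
    exact hg (D.injective_map h')
  refine ⟨{ D with π := D.π ≫ g, injective_map := hinj }, ξ, hξ, hξ', ?_, ?_⟩
  · change D.an.pullback k (complexBetti.map (D.π ≫ g) k a) =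
      D.deRham D.an.carrier k (complexDeRhamCohomology.mk D.E D.an.carrier k ⟨_, hξ⟩)
    rw [complexBetti.map_comp]
    exact e₁
  · change D.anConj.pullback k (complexBetti.map (conjHom σ (D.π ≫ g)) k b) =
      D.deRham D.anConj.carrier k (complexDeRhamCohomology.mk D.E D.anConj.carrier k ⟨_, hξ'⟩)
    rw [← map_conjHom_map_conjHom_apply]
    exact e₂

end AbsoluteReductionAbsoluteOfIso

open AbsoluteReductionAbsoluteOfIso in
/-- **Stub S1 of line `generic-flatness` (crux `AbsoluteReduction`, stmt-HodgeConjecture-15945):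
absolute Hodge classes transport along isomorphisms.** For an isomorphism `e : X' ≅ X` of smooth
projective `ℂ`-schemes of dimension `n` and an absolute Hodge class `c` on `X`, the class `e^* c` is
absolute Hodge on `X'`: rationality and Hodge type transport (`IsoTransport`); a chart `D` of `X`
composed with `e⁻¹` is a chart of `X'` carrying the conjugate `c'` of `c` to the conjugate
`(e^σ)^* c'` of `e^* c`; an arbitrary chart `D''` of `X'` composed with `e` is a chart of `X` carrying a
conjugate `c''` of `e^* c` to the conjugate `((e⁻¹)^σ)^* c'' = periodTwist σ p • β` of `c`, and
`c'' = periodTwist σ p • (e^σ)^* β` with `(e^σ)^* β` rational of type `(p,p)` on `X'^σ`. (The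
smooth-projectivity hypotheses are part of the registered signature and not used.)
[cite: CharlesSchnell2014Notes, Def. 11.2.3] -/
theorem stub_absoluteOfIso :
    ∀ ⦃n : ℕ⦄ ⦃X X' : SchemeOver ℂ⦄ (e : X' ≅ X), IsSmoothProjective n X → IsSmoothProjective n X' →
      ∀ (p : ℕ) (c : complexBetti X (2 * p)), IsAbsoluteHodgeClass n X p c →
        IsAbsoluteHodgeClass n X' p (complexBetti.map e.hom (2 * p) c) := by
  intro n X X' e _ _ p c hc
  refine ⟨(isRationalClass_map_iff_of_iso e).2 hc.1, (isOfHodgeType_map_iff_of_iso e).2 hc.2.1,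
    fun σ ↦ ⟨?_, fun c'' hc'' ↦ ?_⟩⟩
  · -- existence of a conjugate of `e^* c`: transport a chart of `X` along `e⁻¹`
    obtain ⟨c', D, hD⟩ := (hc.2.2 σ).1
    refine ⟨complexBetti.map (conjHom σ e.hom) (2 * p) c',
      isConjugateClass_of_conjugates_map D e.inv (injective_map_conjHom_inv e) ?_⟩
    rw [e.complexBetti_map_inv_map_hom, map_conjHom_inv_map_conjHom_hom_apply]
    exact hD
  · -- every conjugate of `e^* c` is a twisted rational `(p,p)` class: transport the chart back along `e`
    obtain ⟨D'', hD''⟩ := hc''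
    have h1 : IsConjugateClass σ X (2 * p) c (complexBetti.map (conjHom σ e.inv) (2 * p) c'') := by
      refine isConjugateClass_of_conjugates_map D'' e.hom (injective_map_conjHom_hom e) ?_
      rw [map_conjHom_hom_map_conjHom_inv_apply]
      exact hD''
    obtain ⟨β, hβ, hβH, hβe⟩ := (hc.2.2 σ).2 _ h1
    refine ⟨complexBetti.map (conjHom σ e.hom) (2 * p) β,
      (isRationalClass_map_iff_of_iso ((baseChangeHom σ.toRingHom).mapIso e)).2 hβ,
      (isOfHodgeType_map_iff_of_iso ((baseChangeHom σ.toRingHom).mapIso e)).2 hβH, ?_⟩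
    have h2 := congrArg (complexBetti.map (conjHom σ e.hom) (2 * p)) hβe
    rwa [map_conjHom_hom_map_conjHom_inv_apply, map_smul] at h2

/-- The registered stub S1 in the shape used by the skeleton's composition `AbsoluteReduction_of`
(hypothesis `hI : Sig.stub_absoluteOfIso`), as a sanity `example`. -/
example : ∀ ⦃n : ℕ⦄ ⦃X X' : SchemeOver ℂ⦄ (e : X' ≅ X), IsSmoothProjective n X →
    IsSmoothProjective n X' → ∀ (p : ℕ) (c : complexBetti X (2 * p)), IsAbsoluteHodgeClass n X p c →
      IsAbsoluteHodgeClass n X' p (complexBetti.map e.hom (2 * p) c) :=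
  stub_absoluteOfIso

end Summit.HodgeConjecture.HodgeConjecture.Theorems

end
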